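import Literature.MathematicalPhysics.QuantumLattice.HubbardScaleReport

/-!
# Absolute homogeneity of the leg-weighted `L¹–L^∞` kernel norm
# (crux `SeededBrokenRegimeBoseFermiPinned` = stmt-HubbardSuperconductivity-14047, route AposterioriCapRg; supports, lead c4; stub `stub_legKernelNormSmul`)

WHAT. Salmhofer's leg-weighted `L¹–L^∞` kernel norm
(`legKernelNorm`, `Literature/MathematicalPhysics/QuantumLattice/HubbardScaleReport.lean`, §3) is
absolutely homogeneous: `‖c • K‖_{wt,ε} = ‖c‖ · ‖K‖_{wt,ε}` for every scalar `c`, with NO sign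
hypothesis on the leg weights `wt` or on `ε`.  This is what pulls the scalar prefactors (`½`,
`(m + 2)(m + 1)`, the `ε`-powers of `weightedKernel`) out of the norm in the estimates of the two
terms of Polchinski's equation; the corollary `‖-K‖_{wt,ε} = ‖K‖_{wt,ε}` handles signs.

HOW. Degree `0`: the norm is `‖K ∅‖`, so this is `‖c * K ∅‖ = ‖c‖ * ‖K ∅‖` (`norm_mul`).  Degree
`m + 1`: the norm is the finite supremum over a distinguished leg `p` and its label `x` of the
weighted pinned fibre sum `ε ^ m · Σ_{X : X p = x} (∏_q wt (X q)) · ‖K X‖` (`legKernelNorm_succ`).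
Pointwise `‖(c • K) X‖ = ‖c‖ · ‖K X‖`, so every pinned sum of `c • K` is `‖c‖` times that of `K`
(`Finset.mul_sum` and commutativity, `pinnedSum_smul`), and the nonnegative factor `‖c‖` commutes
with both suprema by `Real.mul_iSup_of_nonneg` — which needs no boundedness or nonemptiness (for
empty `Γ` both sides are `0`).

SOURCES. M. Salmhofer, Commun. Math. Phys. 194 (1998) 249–295, §4.1 (the norm, before Lemma 1)
[`Salmhofer1998`]; the identity itself is finite-dimensional bookkeeping, folklore (the tree proves
the same identity for the sectorised norm, `sectorisedKernelNorm_smul` in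
`Literature/MathematicalPhysics/QuantumLattice/SectorisedKernelNorm.lean`, whose proof is adapted here).

The file proves the generic lemmas over any `RCLike` scalar field and any finite label type in the
sub-namespace `LegKernelNormSmul` (`pinnedSum_smul`, `legKernelNorm_smul`, `legKernelNorm_neg`), then
the registered stub (scalars `ℂ`).
-/

set_option linter.dupNamespace false -- `Summit.<S>.<S>` doubles the summit name (tree convention)

namespace Summit.HubbardSuperconductivity.HubbardSuperconductivity.Theorems.AposterioriCapRgSeededBrokenRegimeBoseFermiPinned

open Literature.MathematicalPhysics.QuantumLattice GrassmannAlgebra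

namespace LegKernelNormSmul

variable {𝕜 : Type*} [RCLike 𝕜] {Γ : Type*} [Fintype Γ] [DecidableEq Γ]

/-- Weighted pinned sums are absolutely homogeneous: the pinned fibre sum of `c • K` at leg `p`,
label `x` is `‖c‖` times that of `K` (pointwise `‖c * K X‖ = ‖c‖ * ‖K X‖`, `Finset.mul_sum`).
[folklore] -/
theorem pinnedSum_smul (wt : Γ → ℝ) (ε : ℝ) (m : ℕ) (c : 𝕜) (K : (Fin (m + 1) → Γ) → 𝕜)
    (p : Fin (m + 1)) (x : Γ) :
    ε ^ m * ∑ X ∈ Finset.univ.filter (fun X : Fin (m + 1) → Γ => X p = x),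
        (∏ q, wt (X q)) * ‖(c • K) X‖ =
      ‖c‖ * (ε ^ m * ∑ X ∈ Finset.univ.filter (fun X : Fin (m + 1) → Γ => X p = x),
        (∏ q, wt (X q)) * ‖K X‖) := by
  -- adapted from `sectorLegSum_smul` (Literature/MathematicalPhysics/QuantumLattice/SectorisedKernelNorm.lean)
  simp only [Pi.smul_apply, smul_eq_mul, norm_mul, Finset.mul_sum]
  exact Finset.sum_congr rfl fun _ _ => by ring

/-- **Absolute homogeneity of the leg-weighted `L¹–L^∞` norm** (generic labels and scalars):
`‖c • K‖_{wt,ε} = ‖c‖ · ‖K‖_{wt,ε}` for every scalar `c`, every weight `wt` and every `ε` (no sign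
hypotheses; `Real.mul_iSup_of_nonneg` needs neither boundedness nor nonemptiness).
[cite: Salmhofer1998, §4.1] -/
theorem legKernelNorm_smul (wt : Γ → ℝ) (ε : ℝ) (m : ℕ) (c : 𝕜) (K : (Fin m → Γ) → 𝕜) :
    legKernelNorm wt ε m (c • K) = ‖c‖ * legKernelNorm wt ε m K := by
  -- adapted from `sectorisedKernelNorm_smul` (Literature/MathematicalPhysics/QuantumLattice/SectorisedKernelNorm.lean)
  cases m with
  | zero => rw [legKernelNorm_zero_left, legKernelNorm_zero_left, Pi.smul_apply, smul_eq_mul, norm_mul]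
  | succ m =>
    rw [legKernelNorm_succ, legKernelNorm_succ, Real.mul_iSup_of_nonneg (norm_nonneg c)]
    refine iSup_congr fun p => ?_
    rw [Real.mul_iSup_of_nonneg (norm_nonneg c)]
    exact iSup_congr fun x => pinnedSum_smul wt ε m c K p x

/-- The leg-weighted norm is even: `‖-K‖_{wt,ε} = ‖K‖_{wt,ε}` (`-K = (-1) • K` and `‖-1‖ = 1`).
[folklore] -/
theorem legKernelNorm_neg (wt : Γ → ℝ) (ε : ℝ) (m : ℕ) (K : (Fin m → Γ) → 𝕜) :
    legKernelNorm wt ε m (-K) = legKernelNorm wt ε m K := by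
  rw [← neg_one_smul 𝕜 K, legKernelNorm_smul, norm_neg, norm_one, one_mul]

/-- Homogeneity for a subtraction written as a sum: `‖K - K'‖_{wt,ε} = ‖K + (-1) • K'‖_{wt,ε}`
(`sub_eq_add_neg`, `neg_one_smul`) — the form in which subadditivity and homogeneity combine to
`‖K - K'‖ ≤ ‖K‖ + ‖K'‖`. [folklore] -/
theorem legKernelNorm_sub_eq (wt : Γ → ℝ) (ε : ℝ) (m : ℕ) (K K' : (Fin m → Γ) → 𝕜) :
    legKernelNorm wt ε m (K - K') = legKernelNorm wt ε m (K + (-1 : 𝕜) • K') := by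
  rw [neg_one_smul, sub_eq_add_neg]

end LegKernelNormSmul

/-! ### The registered stub -/

/-- **`stub_legKernelNormSmul`**: absolute homogeneity of Salmhofer's leg-weighted `L¹–L^∞` kernel
norm, `‖c • K‖_{wt,ε} = ‖c‖ · ‖K‖_{wt,ε}` for every complex scalar `c` (complex kernels, any finite
label type, no sign hypotheses on `wt` or `ε`). [cite: Salmhofer1998, §4.1] -/
theorem stub_legKernelNormSmul :
    ∀ {Γ : Type} [Fintype Γ] [DecidableEq Γ] (wt : Γ → ℝ) (ε : ℝ) (m : ℕ) (c : ℂ) (K : (Fin m → Γ) → ℂ),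
      legKernelNorm wt ε m (c • K) = ‖c‖ * legKernelNorm wt ε m K := by
  intro Γ _ _ wt ε m c K
  exact LegKernelNormSmul.legKernelNorm_smul wt ε m c K

end Summit.HubbardSuperconductivity.HubbardSuperconductivity.Theorems.AposterioriCapRgSeededBrokenRegimeBoseFermiPinned
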